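/-
Copyright: lit-balaban Phase-2 proof seat p09 (gen 6).  Statement-level skeleton of a published paper; no proof claims beyond what the
kernel checks below.
-/
import Literature.MathematicalPhysics.QuantumFieldTheory.BalabanImbrieJaffe1984to88.BIJ85Eq611Torus
import Literature.MathematicalPhysics.QuantumFieldTheory.Balaban1983to89.B5Eq165AxialMinV1
import Literature.MathematicalPhysics.QuantumFieldTheory.Balaban1983to89.B5Eq119TorusBridge
import Literature.MathematicalPhysics.QuantumFieldTheory.Balaban1983to89.B5Eq166GaussDeltaK
import Literature.MathematicalPhysics.QuantumFieldTheory.Balaban1983to89.B6Cov2156TorusDelK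
import Literature.MathematicalPhysics.QuantumFieldTheory.Balaban1983to89.B3Bound323ZeroTorus

/-!
# `BalabanImbrieJaffe1984to88.BIJ85Eq431DeltaKBridge` — T. Bałaban, J. Imbrie, A. Jaffe, *Renormalization of the Higgs model: minimizers,
propagators and the stability of mean field theory*, Commun. Math. Phys. **97** (1985) 299–329 [BalabanImbrieJaffe1985], Sect. 4.3 p. 311:
**the action Δ_k of (4.3.1)–(4.3.2) ON THE TORI of the series IS the Δ_k of [6I] = T. Bałaban, *Propagators and renormalization
transformations for lattice gauge theories. I*, Commun. Math. Phys. **95** (1984) 17–40 [Balaban1984PropagatorsI] (1.19)/(1.65)** —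
p. 311: *"The actions Δ_k and propagators C^{(k)} were studied by Balaban [6II]"* — as a quadratic form, as an operator, and ENTRYWISE as
`Re Δ_k` of the genuine (1.65) operator of the tree's β cell; whence THE KERNEL OF Δ_k DECAYS EXPONENTIALLY on the tori, uniformly in `k`
and in the volume (the [6II] p. 250 input of (4.3.5)/(7.2.3), T. Bałaban, *Propagators … II*, Commun. Math. Phys. **96** (1984) 223–250
[Balaban1984PropagatorsII]), with NO hypothesis

statement-level skeleton of published theorems with citation tags; proofs where landed; nothing here is a claim about the Yang–Mills mass gap

PDF held: `paper:balaban1985-cmp97-bij-higgs-minimizers` (journal page = PDF page + 298); p. 311 [PDF 13] and p. 325 [PDF 27] read this session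
from the materialised text (`~/.lit/texts/paper-balaban1985-cmp97-bij-higgs-minimizers/p0013.txt`, `p0027.txt`); [6I] p. 29 / [6II] p. 250 through
the verbatim quotations in the headers of `…Balaban1983to89.B6Cov2156TorusDelK` (pub-balaban cell; page renders cited there).

THE PRINTED TEXT (verbatim).  p. 311: *"The quadratic form σ_k simplifies on curls, namely for fields f of the form f = ∂B. In particular
⟨∂B, σ_k∂B⟩ = ⟨B, Δ_kB⟩, (4.3.1) which defines an action Δ_k. … = Z_{k,Ax}^{−1}∫𝒟Aδ(Q_kA − B)δ_{k,Ax}(A)exp(−½‖∂A‖²) = exp(−½⟨B, Δ_kB⟩).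
(4.3.2) … The action Δ_k yields the unit lattice propagator C^{(k)} … (4.3.3) The actions Δ_k and propagators C^{(k)} were studied by Balaban
[6II] who established that C^{(k)} is well defined and is bounded in norm ‖C^{(k)}‖ ≤ c (4.3.4) uniformly in k. Furthermore C^{(k)} has a
kernel which decays exponentially, uniformly in k. |C^{(k)}(x, y)| ≤ a exp(−b|x − y|). (4.3.5)"*; p. 325: *"The unit lattice propagator C^{(k)}
also has exponential decay, |C^{(k)}_{μν}(x, y)| ≤ Me^{−δ|x−y|}, (7.2.3) for x, y ∈ T₁^{(k)}. This inequality follows from the bound (2.157) in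
[6II] and from the general theorem on unit lattice operators in [7]."*  [6II] p. 250: *"C is a short-ranged operator, so C*Δ_kC has the same
exponential decay as Δ_k."*  [6I] p. 29: *"The action Δ_k is thus defined by ⟨B, Δ_kB⟩ = ⟨∂H_kB, ∂H_kB⟩. (1.65)"*; p. 20: *"((ST)^k e^{−S})(B)
= Z_{k,Ax} exp(−½⟨B, Δ_kB⟩). (1.19)"*.

CITATION HEADER (lean-in-tree rule).  Part of the lit-balaban TYPED SKELETON (HOME `run/shared/lean/pub/lit-balaban/`), Phase-2 seat p09
GEN 6 (gens 1–5: `BIJ85AxialPropagator411` … `BIJ85Ineq434Proof`, `BIJ85Ineq722Proof/Part2/Torus/DeltaA`, `BIJ85Eq721MinimizerKernel`): rows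
**C1.Eq4.3.1-4.3.3** (the Δ_k member), **C1.Eq4.3.4-4.3.5** and **C1.Eq7.2.3** of `HOME/SKELETON.md` (owner r15, referee ref-5) — the JUNCTION
with rows **B5.Eq1.19 / B5.Eq1.64-1.66** ([6I] Δ_k; owner r02).  File 1 of the gen-6 programme «(7.2.3) for the ACTUAL C^{(k)}»: the seat's
gen-3 file `BIJ85Ineq434Proof` proves (4.3.5)/(7.2.3) for the (4.3.3) propagator from three [6II] inputs OF PRINTED SHAPE (hypotheses `hMΔ` +
`hΔd` = kernel decay of Δ_k, `hcoer` = (2.153), the parametrisation (2.155)); THIS FILE DISCHARGES `hMΔ`/`hΔd` for the torus instance of record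
(`deltaOp (V411 P k) (curlOp (η^d) (L^k)) (QsE P k)`, seats p09/p30) by identifying the (4.3.1) action with the objects for which the pub-balaban
cell proved everything: V1 `B5Eq119GaussianV1.DeltaK` (seat p38) = tower `B5Eq114Gauss.DeltaK` (seat p16 `B5Eq119TorusBridge.tB_DeltaK_mulVec`)
= β `Beta.BlockEffectiveAction.DelK` (seat p21 `B5Eq166GaussDeltaK.cplx_DeltaK`) whose kernel decay is pv09's
`B6Cov2156TorusDelK.re_DelK_decay`.  Decls used BY NAME (nothing restated): p30 `BIJ85Sigma421Torus.deltaTorus`, `BIJ85Eq611Torus.inner_deltaOp_torus`,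
`BIJ85Eq531Inputs.QsstarIter/deltaAx_QsstarIter/bondAvgIter_QsstarIter`; p09 `BIJ85AxialMinimizer413.torusHax_congr`, `BIJ85UnitPropagator433.deltaOp/
inner_deltaOp/deltaOp_symm`, `BIJ85Prop521Torus.CoarseSpace/toEj/QsE`; p38 `B5Eq165AxialMinV1.dotProduct_DeltaK_eq_torusHax`,
`B5Eq119GaussianV1.DeltaK_isSymm/dotProduct_DeltaK_gaugeShift/DeltaK_mulVec_grad`, `B5Eq117CompositionV1.mem_fibreIter(_iff)`; p16
`B5Eq117TorusCarriers.tB/Mk`; p21 `B5Eq166GaussDeltaK.DeltaK_apply_eq_re`; pv09 `B6Cov2156TorusDelK.re_DelK_decay`, `B6BondEliminationTorus.pdist`,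
`B6LowerBound2153Torus.rep`; p39 `B3Bound323ZeroTorus.T_eq_supDist`.

WHAT IS PROVED (kernel; standing range `k ≤ m + K`; `w > 0`, `c ≠ 0` in §§1–2, the physical normalisation `w = η^d`, `c = η⁻¹ = L^k` in §§3–4):
* §1 **(4.3.1) = (1.19)/(1.65) as quadratic forms**: `deltaTorus_eq_dotProduct_DeltaK` — `deltaTorus w c k B = B ⬝ᵥ (DeltaK P k w c *ᵥ B)` (the printed
  representative `Q^{s*}_kB` of (4.3.2) and p38's fibre coordinate represent the same class, `torusHax_congr`); `inner_deltaOp_torus_eq_dotProduct`.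
* §2 **as operators** (polarization, both symmetric): `deltaOp_eq_matOp`/`deltaOp_apply` — `(∂H_{k,Ax})^*(∂H_{k,Ax})B = Δ_k·B` componentwise;
  `toEuclideanLin_DeltaK_eq_deltaOp` (THE `hMΔ` of `BIJ85Ineq434Proof.kernel_decay_unitPropagator` at the torus data); `deltaOp_single_apply` (the
  kernel `(Δ_kδ_{b′})(b) = Δ_k(b, b′)`).
* §3 **entrywise = `Re Δ_k` of the genuine (1.65) operator**: `DeltaK_entry_eq_re_DelK` — `Δ_k(b, b′) = Re (Beta.BlockEffectiveAction.DelK (L^k))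
  ((b₋, μ), (b′₋, ν))` for every dummy `a > 0` (`torIdx b = (b₋, μ)`: `Site P k` IS `Tor (Mk P k)`).
* §4 **THE KERNEL OF Δ_k DECAYS** (`hΔd` DISCHARGED): `DeltaK_kernel_decay`/`deltaOp_kernel_decay` — ∃ `c₀, δ₀ > 0` depending on `d` ONLY such that
  for every torus `Setup` of dimension `d`, every `k ≤ m + K` and all bonds `|Δ_k(b, b′)| ≤ c₀e^{−δ₀|b₋ − b′₋|}`, `|·|` = `supDist` = the `distU` of
  the Sect. 7.2 torus carrier; `pdist_rep_eq_supDist` (pv09's periodic sup-distance IS `supDist`).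
* §5 pure gauges: `deltaTorus_gaugeShift`, `deltaTorus_grad`, `deltaOp_grad` (`Δ_k∂λ = 0`), `curlOp_Hop_grad` (`∂H_{k,Ax}∂λ = 0`).
HONEST SCOPE.  (i) Torus model of the series (`Setup`, periodic b.c.), U = 1, real abelian fields — as in every file of this lineage.  (ii) NOT here:
(2.153) on the constraint subspace of (4.3.3) and the parametrisation (2.155) (`hcoer` and `C` of `kernel_decay_unitPropagator`) — files 2–3 of
the programme; nor (4.3.4), nor (1.67) for the torus Δ_k.  (iii) Constants `(c₀, δ₀)` are the pub-balaban cell's (existential, `d`-dependent only).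
(iv) Two `def`s with bodies (`matOp` = the operator of a matrix on `ℝⁿ` without `DecidableEq`; `torIdx` = a bond read as an index of the β cell),
no `def … : Prop`, no new named fact (D-0026).  Unit `lit-balaban-p09` (literature-prover-lit-balaban-p09-g6-0), 2026-08-21.
-/

namespace Literature.MathematicalPhysics.QuantumFieldTheory.BalabanImbrieJaffe1984to88.BIJ85Eq431DeltaKBridge

open Literature.MathematicalPhysics.QuantumFieldTheory.Balaban1983to89
open scoped BigOperators Matrix RealInnerProductSpace
open LatticeFieldCalculus
open BIJ85AxialPropagator411 (constraint411 mem_constraint411 BondSpace toE curlOp V411)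
open BIJ85AxialMinimizer413 (torusHax torusHax_congr)
open BIJ85UnitPropagator433 (deltaOp inner_deltaOp deltaOp_symm)
open BIJ85Prop521Torus (CoarseSpace toEj QsE Wstep)
open BIJ85Sigma421Torus (deltaTorus)
open BIJ85Eq531Inputs (QsstarIter deltaAx_QsstarIter bondAvgIter_QsstarIter)
open BIJ85Eq611Torus (inner_deltaOp_torus)
open B5Eq117CompositionV1 (fibreIter mem_fibreIter mem_fibreIter_iff faceFieldIter)
open B5Eq165AxialMinV1 (dotProduct_DeltaK_eq_torusHax)

noncomputable section

variable {P : Params} {k : ℕ}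

/-! ## §1  (4.3.1): the torus action `⟨B, Δ_kB⟩` of [BalabanImbrieJaffe1985] IS the (1.19)/(1.65) form of [6I] on V1 -/

/-- The printed representative `Q^{s*}_kB` of (4.3.2)/(5.3.1) and the fibre coordinate `faceFieldIter k B` of (1.17) represent THE SAME
class `{Q_kA = B, δ_{k,Ax}(A)}`: their difference lies in the null space `δ(Q_kA)δ_{k,Ax}(A)`. [cite: BalabanImbrieJaffe1985, (4.3.2) p.311] -/
theorem QsstarIter_sub_faceFieldIter_mem (hk : k ≤ P.m + P.K) (B : PBond P k → ℝ) :
    QsstarIter k B - faceFieldIter k B ∈ (constraint411 k : Submodule ℝ (VecField P 0 ℝ)) :=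
  (mem_fibreIter_iff hk B _).1 ((mem_fibreIter k B _).2 ⟨deltaAx_QsstarIter hk B, bondAvgIter_QsstarIter hk B⟩)

/-- The axial minimizers of the two representatives coincide: `H_{k,Ax}B = torusHax w c k (Q^{s*}_kB) = torusHax w c k (faceFieldIter k B)`.
[cite: BalabanImbrieJaffe1985, (4.1.3) p.310] -/
theorem torusHax_QsstarIter_eq (hk : k ≤ P.m + P.K) (w c : ℝ) (B : PBond P k → ℝ) :
    torusHax w c k (QsstarIter k B) = torusHax w c k (faceFieldIter k B) :=
  torusHax_congr w c k (QsstarIter_sub_faceFieldIter_mem hk B)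

/-- **(4.3.1) Δ_k OF [BalabanImbrieJaffe1985] = (1.19)/(1.65) Δ_k OF [6I], on the tori**: the torus action `⟨B, Δ_kB⟩ = deltaTorus w c k B`
(the right member of (4.3.2), seat p30) equals the quadratic form `B·Δ_kB` of the V1 matrix `Δ_k = W_k†W_k` DEFINED by the k-fold Gaussian
(1.19) of [6I] (`B5Eq119GaussianV1.DeltaK`, seat p38) — p. 311: *"The actions Δ_k and propagators C^{(k)} were studied by Balaban [6II]"*.
[cite: BalabanImbrieJaffe1985, (4.3.1) p.311] -/
theorem deltaTorus_eq_dotProduct_DeltaK (hk : k ≤ P.m + P.K) {w : ℝ} (hw : 0 < w) {c : ℝ} (hc : c ≠ 0)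
    (B : PBond P k → ℝ) :
    deltaTorus w c k B = B ⬝ᵥ (B5Eq119GaussianV1.DeltaK P k w c *ᵥ B) := by
  rw [deltaTorus, torusHax_QsstarIter_eq hk, dotProduct_DeltaK_eq_torusHax hk hw hc]

/-- **(4.3.1) at the operator level**: the quadratic form of the symmetric operator `Δ_k = (∂H_{k,Ax})^*(∂H_{k,Ax})` (seat p09 gen 2's
`deltaOp` at the torus data of `BIJ85Eq611Torus`) is `B·Δ_kB` for the (1.19) matrix. [cite: BalabanImbrieJaffe1985, (4.3.1) p.311] -/
theorem inner_deltaOp_torus_eq_dotProduct (hk : k ≤ P.m + P.K) {w : ℝ} (hw : 0 < w) {c : ℝ} (hc : c ≠ 0)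
    (B : CoarseSpace P k) :
    ⟪B, deltaOp (V411 P k) (curlOp (P := P) w c) (QsE P k) B⟫ =
      (WithLp.ofLp B) ⬝ᵥ (B5Eq119GaussianV1.DeltaK P k w c *ᵥ WithLp.ofLp B) := by
  rw [inner_deltaOp_torus hk hc hw, deltaTorus_eq_dotProduct_DeltaK hk hw hc]
  rfl

/-! ## §2  The operator identity: the matrix of `Δ_k = (∂H_{k,Ax})^*(∂H_{k,Ax})` in the bond basis IS the (1.19) matrix -/

section Polar

variable {E : Type*} [NormedAddCommGroup E] [InnerProductSpace ℝ E]

/-- polarization: two symmetric operators with the same quadratic form are equal. [folklore] -/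
private theorem eq_of_symm_of_quad (S S' : E →ₗ[ℝ] E) (hS : ∀ x y, ⟪S x, y⟫ = ⟪x, S y⟫) (hS' : ∀ x y, ⟪S' x, y⟫ = ⟪x, S' y⟫)
    (h : ∀ x, ⟪x, S x⟫ = ⟪x, S' x⟫) : S = S' := by
  refine LinearMap.ext fun y => ext_inner_left ℝ fun x => ?_
  have e1 : ⟪x + y, S (x + y)⟫ = ⟪x, S x⟫ + 2 * ⟪x, S y⟫ + ⟪y, S y⟫ := by
    rw [map_add, inner_add_left, inner_add_right, inner_add_right, ← hS y x, real_inner_comm (S y) x]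
    ring
  have e2 : ⟪x + y, S' (x + y)⟫ = ⟪x, S' x⟫ + 2 * ⟪x, S' y⟫ + ⟪y, S' y⟫ := by
    rw [map_add, inner_add_left, inner_add_right, inner_add_right, ← hS' y x, real_inner_comm (S' y) x]
    ring
  have h3 := h (x + y)
  rw [e1, e2, h x, h y] at h3
  linarith

end Polar

section MatOp

variable {n : Type} [Fintype n]

/-- the operator `x ↦ Mx` of a real matrix on `ℝⁿ = EuclideanSpace ℝ n` (no `DecidableEq` needed; under `DecidableEq n` this is
`Matrix.toEuclideanLin M`, `matOp_eq_toEuclideanLin`). [folklore] -/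
def matOp (M : Matrix n n ℝ) : EuclideanSpace ℝ n →ₗ[ℝ] EuclideanSpace ℝ n :=
  (WithLp.linearEquiv 2 ℝ (n → ℝ)).symm.toLinearMap ∘ₗ M.mulVecLin ∘ₗ (WithLp.linearEquiv 2 ℝ (n → ℝ)).toLinearMap

/-- `matOp M x = M(x)`, componentwise. [folklore] -/
private theorem matOp_apply (M : Matrix n n ℝ) (x : EuclideanSpace ℝ n) : matOp M x = WithLp.toLp 2 (M *ᵥ WithLp.ofLp x) := rfl

/-- the quadratic/bilinear form of `matOp M` is the `dotProduct` form. [folklore] -/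
private theorem inner_matOp (M : Matrix n n ℝ) (x y : EuclideanSpace ℝ n) :
    ⟪x, matOp M y⟫ = (WithLp.ofLp x) ⬝ᵥ (M *ᵥ WithLp.ofLp y) := by
  rw [matOp_apply, EuclideanSpace.inner_eq_star_dotProduct, WithLp.ofLp_toLp, star_trivial, dotProduct_comm]

/-- the operator of a symmetric matrix is symmetric. [folklore] -/
private theorem matOp_symm {M : Matrix n n ℝ} (hM : M.IsSymm) (x y : EuclideanSpace ℝ n) : ⟪matOp M x, y⟫ = ⟪x, matOp M y⟫ := by
  rw [real_inner_comm, inner_matOp, inner_matOp, Matrix.dotProduct_mulVec, ← Matrix.mulVec_transpose, hM.eq, dotProduct_comm]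

/-- under `DecidableEq n`, `matOp M = Matrix.toEuclideanLin M`. [folklore] -/
private theorem matOp_eq_toEuclideanLin [DecidableEq n] (M : Matrix n n ℝ) : matOp M = Matrix.toEuclideanLin M := rfl

end MatOp

/-- **THE (4.3.1) OPERATOR `Δ_k = (∂H_{k,Ax})^*(∂H_{k,Ax})` IS THE OPERATOR OF THE (1.19) MATRIX** on the unit-lattice bond fields
`CoarseSpace P k` (seat p09 gen 2's `deltaOp` at the torus data; polarization of §1). [cite: BalabanImbrieJaffe1985, (4.3.1) p.311] -/
theorem deltaOp_eq_matOp (hk : k ≤ P.m + P.K) {w : ℝ} (hw : 0 < w) {c : ℝ} (hc : c ≠ 0) :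
    deltaOp (V411 P k) (curlOp (P := P) w c) (QsE P k) = matOp (B5Eq119GaussianV1.DeltaK P k w c) :=
  eq_of_symm_of_quad _ _ (deltaOp_symm _ _ _) (matOp_symm (B5Eq119GaussianV1.DeltaK_isSymm k w c))
    fun B => by rw [inner_matOp, inner_deltaOp_torus_eq_dotProduct hk hw hc]

/-- `Δ_kB = Δ_k·B` componentwise: the (4.3.1) operator acts by the (1.19) matrix. [cite: BalabanImbrieJaffe1985, (4.3.1) p.311] -/
theorem deltaOp_apply (hk : k ≤ P.m + P.K) {w : ℝ} (hw : 0 < w) {c : ℝ} (hc : c ≠ 0) (B : CoarseSpace P k) :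
    deltaOp (V411 P k) (curlOp (P := P) w c) (QsE P k) B = WithLp.toLp 2 (B5Eq119GaussianV1.DeltaK P k w c *ᵥ WithLp.ofLp B) := by
  rw [deltaOp_eq_matOp hk hw hc, matOp_apply]

/-- **THE MATRIX OF THE (4.3.1) OPERATOR IN THE BOND BASIS IS THE (1.19) MATRIX**: `toEuclideanLin (DeltaK P k w c) = (∂H_{k,Ax})^*(∂H_{k,Ax})`
— the hypothesis `hMΔ` of seat p09 gen 3's `BIJ85Ineq434Proof.kernel_decay_unitPropagator` for the torus instance of (4.3.3) (any
`DecidableEq` instance on the bonds). [cite: BalabanImbrieJaffe1985, (4.3.1) p.311] -/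
theorem toEuclideanLin_DeltaK_eq_deltaOp [DecidableEq (PBond P k)] (hk : k ≤ P.m + P.K) {w : ℝ} (hw : 0 < w) {c : ℝ} (hc : c ≠ 0) :
    Matrix.toEuclideanLin (B5Eq119GaussianV1.DeltaK P k w c) = deltaOp (V411 P k) (curlOp (P := P) w c) (QsE P k) := by
  rw [deltaOp_eq_matOp hk hw hc, matOp_eq_toEuclideanLin]

/-- entrywise: `(Δ_kδ_{b′})(b) = Δ_k(b, b′)` — the kernel of the (4.3.1) operator is the (1.19) matrix. [cite: BalabanImbrieJaffe1985, (4.3.1) p.311] -/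
theorem deltaOp_single_apply [DecidableEq (PBond P k)] (hk : k ≤ P.m + P.K) {w : ℝ} (hw : 0 < w) {c : ℝ} (hc : c ≠ 0)
    (b b' : PBond P k) :
    deltaOp (V411 P k) (curlOp (P := P) w c) (QsE P k) (EuclideanSpace.single b' 1) b = B5Eq119GaussianV1.DeltaK P k w c b b' := by
  rw [deltaOp_apply hk hw hc, PiLp.ofLp_single, Matrix.mulVec_single_one]
  rfl

/-! ## §3  Entrywise: the (4.3.1) = (1.19) matrix IS `Re Δ_k` of the genuine (1.65) operator of the β cell -/

/-- the bond `b = ⟨x, x + e_μ⟩` of `T₁^{(k)}` read as the index `(x, μ)` of the β cell's `Tor (Mk P k) × Fin d` (`Site P k` IS `Tor (Mk P k)`;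
`= bondEquiv⁻¹ b`). [cite: Balaban1984PropagatorsI, (1.17) p.20] -/
def torIdx (b : PBond P k) : B5Prop11Plancherel.Tor (B5Eq117TorusCarriers.Mk P k) × Fin P.d := (b.src, b.dir)

/-- `torIdx` is the inverse of `bondEquiv` (bonds `⟨x, x + e_μ⟩ ↔ (x, μ)`). [cite: Balaban1984PropagatorsI, (1.17) p.20] -/
theorem torIdx_eq (b : PBond P k) : torIdx b = (bondEquiv (P := P) (j := k)).symm b := rfl

/-- `torIdx` is injective (a bond is its source and direction). [cite: Balaban1984PropagatorsI, (1.17) p.20] -/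
theorem torIdx_injective : Function.Injective (torIdx (P := P) (k := k)) := fun _ _ h =>
  (bondEquiv (P := P) (j := k)).symm.injective h

/-- `η = L^{−k} > 0` (the spacing of `T_η`). [cite: Balaban1984PropagatorsI, (1.17) p.20] -/
theorem eta_pow_pos (P : Params) (k n : ℕ) : 0 < P.eta k ^ n :=
  pow_pos (pow_pos (inv_pos.mpr (Nat.cast_pos.mpr P.L_pos)) k) n

/-- `η⁻¹ = L^k ≠ 0` (the lattice factor of `∂^η`). [cite: Balaban1984PropagatorsI, (1.17) p.20] -/
theorem Lpow_ne_zero (P : Params) (k : ℕ) : ((P.L : ℝ) ^ k) ≠ 0 := pow_ne_zero _ (Nat.cast_ne_zero.mpr P.L_pos.ne')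

/-- `η = L^{−k}`: the spacing of `Setup` is the `η` of the B5 tower files. [cite: Balaban1984PropagatorsI, (1.17) p.20] -/
theorem eta_eq (P : Params) (k : ℕ) : B5SectBStatements.eta P.L k = P.eta k := by
  rw [B5SectBStatements.eta, Params.eta, inv_pow]

/-- `n = L^k ≥ 1` (the block size of the one-stroke average `Q_k`, (1.18)). [cite: Balaban1984PropagatorsI, (1.18) p.20] -/
theorem one_le_Lpow (P : Params) (k : ℕ) : 1 ≤ P.L ^ k := Nat.one_le_pow k P.L P.L_pos

/-- the transported basis field: `tB δ_{b′} = δ_{torIdx b′}` as a function on `Tor (Mk P k) × Fin d`. [folklore] -/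
private theorem cplx_tB_single [DecidableEq (PBond P k)] (b' : PBond P k) :
    B5SectBStatements.cplx (B5Eq117TorusCarriers.tB (P := P) (k := k) (Pi.single b' 1))
      = Pi.single (torIdx b') (1 : ℂ) := by
  funext j
  rw [B5SectBStatements.cplx, B5Eq117TorusCarriers.tB_apply]
  by_cases h : j = torIdx b'
  · subst h
    rw [Pi.single_eq_same]
    have e : (⟨(torIdx b').1, (torIdx b').2⟩ : PBond P k) = b' := rfl
    rw [e, Pi.single_eq_same, Complex.ofReal_one]
  · rw [Pi.single_eq_of_ne h]
    have hne : (⟨j.1, j.2⟩ : PBond P k) ≠ b' := fun e => h (by rw [← e]; rfl)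
    rw [Pi.single_eq_of_ne hne, Complex.ofReal_zero]

/-- **THE (4.3.1) = (1.19) MATRIX IS `Re Δ_k` OF THE GENUINE (1.65) OPERATOR `Beta.BlockEffectiveAction.DelK (L^k)`**, entrywise, for the
physical normalisation `w = η^d`, `c = η⁻¹ = L^k` (every dummy `a > 0`): seat p16's `B5Eq119TorusBridge.tB_DeltaK_mulVec` (V1 ↔ tower) and
seat p21's `B5Eq166GaussDeltaK.cplx_DeltaK` (tower ↔ β) composed at the basis fields.
[cite: BalabanImbrieJaffe1985, (4.3.1) p.311; Balaban1984PropagatorsI, (1.65) p.29] -/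
theorem DeltaK_entry_eq_re_DelK (hk : k ≤ P.m + P.K) (a : ℝ) (ha : 0 < a) (b b' : PBond P k) :
    B5Eq119GaussianV1.DeltaK P k (P.eta k ^ P.d) ((P.L : ℝ) ^ k) b b'
      = (Beta.BlockEffectiveAction.DelK (P.L ^ k) (one_le_Lpow P k) (B5Eq117TorusCarriers.Mk P k) a ha
          (torIdx b) (torIdx b')).re := by
  classical
  have h1 := B5Eq119TorusBridge.tB_DeltaK_mulVec hk (Pi.single b' (1 : ℝ))
  rw [eta_eq] at h1
  calc B5Eq119GaussianV1.DeltaK P k (P.eta k ^ P.d) ((P.L : ℝ) ^ k) b b'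
      = (B5Eq119GaussianV1.DeltaK P k (P.eta k ^ P.d) ((P.L : ℝ) ^ k) *ᵥ Pi.single b' (1 : ℝ)) b := by
        rw [Matrix.mulVec_single_one]; rfl
    _ = B5Eq117TorusCarriers.tB (P := P) (k := k)
          (B5Eq119GaussianV1.DeltaK P k (P.eta k ^ P.d) ((P.L : ℝ) ^ k) *ᵥ Pi.single b' (1 : ℝ)) (torIdx b) := rfl
    _ = B5Eq114Gauss.DeltaK P.L (B5Eq117TorusCarriers.Mk P k) k
          (B5Eq117TorusCarriers.tB (P := P) (k := k) (Pi.single b' (1 : ℝ))) (torIdx b) := by rw [h1]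
    _ = ((Beta.BlockEffectiveAction.DelK (P.L ^ k) (one_le_Lpow P k) (B5Eq117TorusCarriers.Mk P k) a ha *ᵥ
          B5SectBStatements.cplx (B5Eq117TorusCarriers.tB (P := P) (k := k) (Pi.single b' (1 : ℝ)))) (torIdx b)).re :=
        B5Eq166GaussDeltaK.DeltaK_apply_eq_re P.L (B5Eq117TorusCarriers.Mk P k) k (one_le_Lpow P k) a ha _ _
    _ = (Beta.BlockEffectiveAction.DelK (P.L ^ k) (one_le_Lpow P k) (B5Eq117TorusCarriers.Mk P k) a ha
          (torIdx b) (torIdx b')).re := by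
        rw [cplx_tB_single, Matrix.mulVec_single_one]; rfl

/-! ## §4  The kernel of `Δ_k` decays exponentially on the tori — the [6II] input of (4.3.5)/(7.2.3) discharged -/

section Dist

open B5Prop11Plancherel (Tor)
open B5Eq117TorusCarriers (Mk)

/-- the periodic residue of the integer representative of a torus point is the point (coordinates `val`). [folklore] -/
private theorem res_rep {d : ℕ} (M : Fin d → ℕ) [∀ μ, NeZero (M μ)] (hM : ∀ i, 1 ≤ M i) (t : Tor M) :
    B6BondEliminationTorus.res M hM (B6LowerBound2153Torus.rep M t) = fun i => ⟨(t i).val, ZMod.val_lt (t i)⟩ := by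
  funext i
  apply Fin.ext
  simp only [B6BondEliminationTorus.res, B6LowerBound2153Torus.rep]
  have h1 : ((t i).val : ℤ) % (M i : ℤ) = (t i).val := by
    apply Int.emod_eq_of_lt (by positivity)
    exact_mod_cast ZMod.val_lt (t i)
  rw [h1, Int.toNat_natCast]

/-- **THE METRIC DICTIONARY**: the periodic sup-distance `ρ_M(rep x, rep y)` of the b06/pv09 torus lineage (in which `re_DelK_decay` and
(2.156) are stated) IS the torus distance `|x − y| = supDist x y` of the unit lattice `T₁^{(k)}` of `Setup` (the `distU` of the Sect. 7.2
kernel carrier, `BIJ85Ineq722Torus.torusRep`). [cite: BalabanImbrieJaffe1985, (7.2.3) p.325] -/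
theorem pdist_rep_eq_supDist (x y : Balaban1983to89.Site P k) :
    B6BondEliminationTorus.pdist (Mk P k) (B6Cov2156Torus.one_le_M (Mk P k)) (B6LowerBound2153Torus.rep (Mk P k) x)
        (B6LowerBound2153Torus.rep (Mk P k) y) = (supDist x y : ℝ) := by
  rw [← B3Bound323ZeroTorus.T_eq_supDist, B6BondEliminationTorus.pdist, res_rep, res_rep]
  rfl

end Dist

/-- **THE KERNEL OF THE (4.3.1) ACTION `Δ_k` DECAYS EXPONENTIALLY, UNIFORMLY IN `k` AND IN THE VOLUME** — the [6II] input of (4.3.5)/(7.2.3)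
(*"C is a short-ranged operator, so C*Δ_kC has the same exponential decay as Δ_k"*, [Balaban1984PropagatorsII] p. 250; hypothesis `hΔd` of
seat p09 gen 3's `BIJ85Ineq434Proof.kernel_decay(_unitPropagator)`) DISCHARGED ON THE TORI: there are `c₀, δ₀ > 0` depending on the
dimension `d` only such that for EVERY torus `Setup` of dimension `d`, every scale `k ≤ m + K` and all unit-lattice bonds,
`|Δ_k(b, b′)| ≤ c₀e^{−δ₀|b₋ − b′₋|}` (pv09's `B6Cov2156TorusDelK.re_DelK_decay` for the genuine (1.65) operator, through §3).
[cite: BalabanImbrieJaffe1985, (4.3.5) p.311; Balaban1984PropagatorsII, p.250] -/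
theorem DeltaK_kernel_decay (d : ℕ) (hd : 1 ≤ d) :
    ∃ c₀ δ₀ : ℝ, 0 < c₀ ∧ 0 < δ₀ ∧ ∀ (P : Params), P.d = d → ∀ (k : ℕ), k ≤ P.m + P.K → ∀ b b' : PBond P k,
      |B5Eq119GaussianV1.DeltaK P k (P.eta k ^ P.d) ((P.L : ℝ) ^ k) b b'| ≤
        c₀ * Real.exp (-(δ₀ * (supDist b.src b'.src : ℝ))) := by
  obtain ⟨c₀, δ₀, hc, hδ, H⟩ := B6Cov2156TorusDelK.re_DelK_decay (d := d) hd
  refine ⟨c₀, δ₀, hc, hδ, fun P hP k hk b b' => ?_⟩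
  subst hP
  haveI : NeZero (P.L ^ k) := ⟨by have := one_le_Lpow P k; omega⟩
  have h := H (B5Eq117TorusCarriers.Mk P k) (P.L ^ k) (one_le_Lpow P k) 1 one_pos (torIdx b) (torIdx b')
  rw [DeltaK_entry_eq_re_DelK hk 1 one_pos, ← pdist_rep_eq_supDist]
  exact h

/-- The same for the kernel of the (4.3.1) OPERATOR `(∂H_{k,Ax})^*(∂H_{k,Ax})` in the bond basis (any `DecidableEq` on the bonds).
[cite: BalabanImbrieJaffe1985, (4.3.5) p.311; Balaban1984PropagatorsII, p.250] -/
theorem deltaOp_kernel_decay (d : ℕ) (hd : 1 ≤ d) :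
    ∃ c₀ δ₀ : ℝ, 0 < c₀ ∧ 0 < δ₀ ∧ ∀ (P : Params), P.d = d → ∀ (k : ℕ) (_ : DecidableEq (PBond P k)), k ≤ P.m + P.K →
      ∀ b b' : PBond P k,
      |deltaOp (V411 P k) (curlOp (P := P) (P.eta k ^ P.d) ((P.L : ℝ) ^ k)) (QsE P k) (EuclideanSpace.single b' 1) b| ≤
        c₀ * Real.exp (-(δ₀ * (supDist b.src b'.src : ℝ))) := by
  obtain ⟨c₀, δ₀, hc, hδ, H⟩ := DeltaK_kernel_decay d hd
  refine ⟨c₀, δ₀, hc, hδ, fun P hP k _ hk b b' => ?_⟩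
  rw [deltaOp_single_apply hk (eta_pow_pos P k P.d) (Lpow_ne_zero P k)]
  exact H P hP k hk b b'

/-! ## §5  Pure gauges: `Δ_k∂λ = 0` and `∂H_{k,Ax}∂λ = 0` for the (4.3.1) objects on the tori -/

/-- the torus action is gauge invariant: `⟨B − ∂λ, Δ_k(B − ∂λ)⟩ = ⟨B, Δ_kB⟩` (every unit-lattice gauge function `λ`, any lattice factor `c′`;
seat p38's `dotProduct_DeltaK_gaugeShift` through §1). [cite: Balaban1984PropagatorsI, (1.15) p.19] -/
theorem deltaTorus_gaugeShift (hk : k ≤ P.m + P.K) {w : ℝ} (hw : 0 < w) {c : ℝ} (hc : c ≠ 0) (c' : ℝ)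
    (lam : SiteField P k ℝ) (B : PBond P k → ℝ) :
    deltaTorus w c k (gaugeShift c' lam B) = deltaTorus w c k B := by
  rw [deltaTorus_eq_dotProduct_DeltaK hk hw hc, deltaTorus_eq_dotProduct_DeltaK hk hw hc]
  exact B5Eq119GaussianV1.dotProduct_DeltaK_gaugeShift hk hw hc c' lam B

/-- pure gauges carry no action: `⟨∂λ, Δ_k∂λ⟩ = 0` on the tori. [cite: Balaban1984PropagatorsI, (1.15) p.19] -/
theorem deltaTorus_grad (hk : k ≤ P.m + P.K) {w : ℝ} (hw : 0 < w) {c : ℝ} (hc : c ≠ 0) (c' : ℝ) (lam : SiteField P k ℝ) :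
    deltaTorus w c k (grad c' lam) = 0 := by
  rw [deltaTorus_eq_dotProduct_DeltaK hk hw hc, B5Eq119GaussianV1.DeltaK_mulVec_grad hk hw hc, dotProduct_zero]

/-- **`Δ_k∂λ = 0` for the (4.3.1) OPERATOR**: pure gauges are zero modes of `(∂H_{k,Ax})^*(∂H_{k,Ax})`.
[cite: Balaban1984PropagatorsI, (1.15) p.19] -/
theorem deltaOp_grad (hk : k ≤ P.m + P.K) {w : ℝ} (hw : 0 < w) {c : ℝ} (hc : c ≠ 0) (c' : ℝ) (lam : SiteField P k ℝ) :
    deltaOp (V411 P k) (curlOp (P := P) w c) (QsE P k) (toEj P k (grad c' lam)) = 0 := by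
  rw [deltaOp_apply hk hw hc]
  have h : WithLp.ofLp (toEj P k (grad c' lam)) = grad c' lam := rfl
  rw [h, B5Eq119GaussianV1.DeltaK_mulVec_grad hk hw hc]
  rfl

/-- **`∂H_{k,Ax}∂λ = 0`**: the axial minimizer of the class of a pure gauge `∂λ` is curl-free (its curl energy `⟨∂λ, Δ_k∂λ⟩` vanishes).
[cite: Balaban1984PropagatorsI, (1.15) p.19] -/
theorem curlOp_Hop_grad (hk : k ≤ P.m + P.K) {w : ℝ} (hw : 0 < w) {c : ℝ} (hc : c ≠ 0) (c' : ℝ) (lam : SiteField P k ℝ) :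
    curlOp (P := P) w c (BIJ85UnitPropagator433.Hop (V411 P k) (curlOp (P := P) w c) (QsE P k) (toEj P k (grad c' lam))) = 0 := by
  have h := inner_deltaOp (V411 P k) (curlOp (P := P) w c) (QsE P k) (toEj P k (grad c' lam))
  rw [deltaOp_grad hk hw hc, inner_zero_right] at h
  exact norm_eq_zero.1 (sq_eq_zero_iff.1 h.symm)

end

end Literature.MathematicalPhysics.QuantumFieldTheory.BalabanImbrieJaffe1984to88.BIJ85Eq431DeltaKBridge
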